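import Mathlib
import Literature.MathematicalPhysics.QuantumFieldTheory.OSSectorContinuation
import Literature.MathematicalPhysics.QuantumFieldTheory.OSReconstructionNoE1Proofs
import HarnessLib

/-!
# Cone chains are diagonal-frame OS pairs (stub `stub_coneChainFrames`, crux `PlanarSpectralCone`)

Line `two-mirror-lightcone-slots` of crux `MirrorModularBoosts.PlanarSpectralCone`
(stmt-QuantumFields-9664), FRONT END, geometry.

Informal statement. Let `S` be a Schwinger family on `ℝ⁴`, translation invariant on `⁰𝒮`, with the
eight-frame pull-back reflection positivity of the crux, and let `G` be a CONE CHAIN, i.e.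
`supp G ⊆ {x | ∀ i, |xᵢ¹| < xᵢ⁰ ∧ ∀ i < j, |xⱼ¹ − xᵢ¹| < xⱼ⁰ − xᵢ⁰}`. Put `e₀, e₁` for the first two
coordinate vectors, `n = (e₀ + e₁)/√2`, `n' = (e₀ − e₁)/√2`, `a(u,u') = u n + u' n'`. Then the two
frames `R₊ = rot(+45°)`, `R₋ = rot(−45°)` of the `(x₀,x₁)`-plane (identity on `x₂, x₃`;
`R₊ e₀ = n`, `R₋ e₀ = n'`) satisfy:

* the pulled-back families `S ∘ linActMulti R±` satisfy the premises `OSReconstructionNoE1`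
  (E2 is the frame hypothesis at `(a,b) = (1/√2, ±1/√2)`; translation invariance on `⁰𝒮` is
  transported by `linActMulti_translateMulti`, isometries preserving `⁰𝒮`);
* with `A± = G ∘ R±⁻¹ = linActMulti R± G`, `B± = linActMulti R±⁻¹ G` (all four e₀-time-ordered,
  since a cone chain is ordered along `n` and along `n'`) one has the Schwartz-map identities
  `ΘG* ⊗ G_{a(u,u')} = linActMulti R₊ (ΘA₊* ⊗ (B₊)_{u e₀ − u' e₁})` and
  `ΘG* ⊗ G_{a(u,u')} = linActMulti R₋ (ΘA₋* ⊗ (B₋)_{u' e₀ + u e₁})`, because conjugating a plane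
  rotation by the reflection `θ` of one of its axes inverts it (`θ R θ = R⁻¹`).

Everything here is elementary coordinate geometry of `ℝ⁴` plus support bookkeeping; the frames are
the plane rotations `planeRot 0 (∓π/4)` of the tree (`OSLorentzInvariance`); `E4` is local notation
for `EuclideanSpace ℝ (Fin 4)`.

References: Osterwalder–Schrader, Comm. Math. Phys. 31 (1973), §2–§4 (the objects `Θ`, `f_{(a,R)}`,
E2); the diagonal-frame rewriting is folklore.
-/

noncomputable section

namespace Summit.QuantumFields.YangMills.Cruxes.PlanarSpectralCone.TwoMirrorLightconeSlots

open MeasureTheory Complex Set Filter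
open scoped InnerProductSpace ComplexConjugate
open Literature.MathematicalPhysics.QuantumLattice Literature.MathematicalPhysics.AQFT
  Literature.MathematicalPhysics.QuantumFieldTheory

local notation "E4" => EuclideanSpace ℝ (Fin 4)

/-! ## The two diagonal frames of the `(x₀,x₁)`-plane -/

/-- The inverse of the plane rotation `planeRot 0 θ` of `ℝ⁴` is `planeRot 0 (-θ)` (pointwise). -/
theorem planeRot_symm_apply_four (θ : ℝ) (y : E4) :
    (planeRot (d := 3) 0 θ).symm y = planeRot (d := 3) 0 (-θ) y := by
  apply (planeRot (d := 3) 0 θ).injective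
  rw [LinearIsometryEquiv.apply_symm_apply]
  have h := planeRotLin_neg_apply_planeRotLin (d := 3) 0 (-θ) y
  rw [neg_neg] at h
  exact h.symm

/-- Conjugating a rotation of the `(x₀,x₁)`-plane by the time reflection `θ` inverts it:
`R_φ θ R_φ = θ` on `ℝ⁴`. -/
theorem planeRot_timeReflection_planeRot (φ : ℝ) (z : E4) :
    planeRot (d := 3) 0 φ (timeReflection 4 (planeRot (d := 3) 0 φ z)) = timeReflection 4 z := by
  have h := Real.cos_sq_add_sin_sq φ
  ext i
  fin_cases i
  · simp [planeRot_apply, timeReflection_apply]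
    linear_combination (-(z 0)) * h
  · simp [planeRot_apply, timeReflection_apply]
    linear_combination (z 1) * h
  · simp [planeRot_apply, timeReflection_apply]
  · simp [planeRot_apply, timeReflection_apply]

/-- `√2 / 2 = 1 / √2`. -/
theorem sqrt_two_div_two : Real.sqrt 2 / 2 = 1 / Real.sqrt 2 := by
  rw [div_eq_div_iff two_ne_zero (Real.sqrt_ne_zero'.2 two_pos), one_mul,
    Real.mul_self_sqrt zero_le_two]

/-- **The two diagonal frames.** For `s = ±1` there is a linear isometry `R` of `ℝ⁴` — the rotation
by `s · 45°` of the `(x₀,x₁)`-plane, identity on `x₂, x₃` — with the listed coordinates of `R` and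
`R⁻¹`, the conjugation rule `R⁻¹ θ R⁻¹ = θ`, and `R e₀ = (e₀ + s e₁)/√2`. -/
theorem exists_diagFrame (s : ℝ) (hs : s = 1 ∨ s = -1) :
    ∃ R : E4 ≃ₗᵢ[ℝ] E4,
      (∀ x : E4, R x 0 = (x 0 - s * x 1) / Real.sqrt 2) ∧
      (∀ x : E4, R x 1 = (s * x 0 + x 1) / Real.sqrt 2) ∧
      (∀ x : E4, R.symm x 0 = (x 0 + s * x 1) / Real.sqrt 2) ∧
      (∀ x : E4, R.symm x 1 = (-s * x 0 + x 1) / Real.sqrt 2) ∧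
      (∀ (x : E4) (i : Fin 4), i ≠ 0 → i ≠ 1 →
        R x i = x i ∧ R.symm x i = x i) ∧
      (∀ z : E4,
        R.symm (timeReflection 4 (R.symm z)) = timeReflection 4 z) ∧
      R (EuclideanSpace.single 0 1) =
        (1 / Real.sqrt 2) • EuclideanSpace.single 0 1 +
          (s / Real.sqrt 2) • EuclideanSpace.single 1 1 := by
  have hc : Real.cos (-(s * (Real.pi / 4))) = 1 / Real.sqrt 2 := by
    rcases hs with rfl | rfl <;> simp [Real.cos_pi_div_four, sqrt_two_div_two]
  have hsn : Real.sin (-(s * (Real.pi / 4))) = -s / Real.sqrt 2 := by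
    rcases hs with rfl | rfl <;> simp [Real.sin_pi_div_four, sqrt_two_div_two, neg_div]
  have hc' : Real.cos (-(-(s * (Real.pi / 4)))) = 1 / Real.sqrt 2 := by
    rw [neg_neg, ← Real.cos_neg, hc]
  have hsn' : Real.sin (-(-(s * (Real.pi / 4)))) = s / Real.sqrt 2 := by
    rw [neg_neg, ← neg_neg (Real.sin _), ← Real.sin_neg, hsn]; ring
  refine ⟨planeRot (d := 3) 0 (-(s * (Real.pi / 4))), fun x => ?_, fun x => ?_, fun x => ?_,
    fun x => ?_, fun x i hi0 hi1 => ⟨?_, ?_⟩, fun z => ?_, ?_⟩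
  · rw [planeRot_apply]; simp only [if_true, Fin.succ_zero_eq_one, hc, hsn]; ring
  · rw [planeRot_apply]
    simp only [one_ne_zero, if_false, Fin.succ_zero_eq_one, if_true, hc, hsn]; ring
  · rw [planeRot_symm_apply_four, planeRot_apply]
    simp only [if_true, Fin.succ_zero_eq_one, hc', hsn']; ring
  · rw [planeRot_symm_apply_four, planeRot_apply]
    simp only [one_ne_zero, if_false, Fin.succ_zero_eq_one, if_true, hc', hsn']; ring
  · rw [planeRot_apply]; simp [hi0, hi1]
  · rw [planeRot_symm_apply_four, planeRot_apply]; simp [hi0, hi1]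
  · rw [planeRot_symm_apply_four, planeRot_symm_apply_four]
    exact planeRot_timeReflection_planeRot _ _
  · ext i
    fin_cases i <;> simp [planeRot_apply, hc, hsn, neg_div]

/-! ## Support bookkeeping under `linActMulti` -/

/-- The support of `linActMulti L G = G ∘ (L⁻¹)^{×m}` is the `L`-image of the support of `G`:
if `x ∈ supp (linActMulti L G)` then `(L⁻¹ xₖ)ₖ ∈ supp G`. -/
theorem mem_tsupport_of_mem_tsupport_linActMulti_four
    (L : E4 ≃ₗᵢ[ℝ] E4) {m : ℕ}
    (G : SchwartzMap (Fin m → E4) ℂ) {x : Fin m → E4}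
    (hx : x ∈ tsupport ((linActMulti L G : SchwartzMap (Fin m → E4) ℂ) :
      (Fin m → E4) → ℂ)) :
    (fun k => L.symm (x k)) ∈ tsupport (G : (Fin m → E4) → ℂ) := by
  set e : (Fin m → E4) ≃ₜ (Fin m → E4) :=
    (ContinuousLinearEquiv.piCongrRight
      fun _ : Fin m => L.symm.toContinuousLinearEquiv).toHomeomorph
  have hcomp : ((linActMulti L G : SchwartzMap (Fin m → E4) ℂ) :
      (Fin m → E4) → ℂ) =
        (G : (Fin m → E4) → ℂ) ∘ e := by
    funext y; rfl
  rw [hcomp, tsupport_comp_eq_preimage] at hx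
  exact hx

/-- `⁰𝒮` is stable under the diagonal action of a linear isometry of `ℝ⁴` (the chain rule for a
continuous linear equivalence; same proof as `CurvatureBoostCovariance.Negative.Unbundled`). -/
theorem isOffDiagonal_linActMulti_four {n : ℕ}
    {F : SchwartzMap (Fin n → E4) ℂ} (hF : IsOffDiagonal F)
    (R : E4 ≃ₗᵢ[ℝ] E4) :
    IsOffDiagonal (linActMulti R F) := by
  -- adapted from
  -- Summits/QuantumFields/YangMills/Theorems/CurvatureBoostCovariance/Negative/Unbundled.lean
  intro x hx k
  set g : (Fin n → E4) ≃L[ℝ] (Fin n → E4) :=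
    ContinuousLinearEquiv.piCongrRight fun _ : Fin n => R.symm.toContinuousLinearEquiv with hg
  have hfun : ((linActMulti R F : SchwartzMap (Fin n → E4) ℂ) :
      (Fin n → E4) → ℂ) =
        (F : (Fin n → E4) → ℂ) ∘ g := by
    funext y; rfl
  have hgx : g x ∈ coincidenceLocus n E4 := by
    obtain ⟨i, j, hij, hxij⟩ := hx
    exact ⟨i, j, hij, by simp [hg, hxij]⟩
  have h0 : iteratedFDeriv ℝ k (F : (Fin n → E4) → ℂ) (g x) = 0 := hF _ hgx k
  have key := (g : (Fin n → E4) →L[ℝ]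
    (Fin n → E4)).iteratedFDeriv_comp_right (F.smooth k) x (i := k) le_rfl
  simp only [ContinuousLinearEquiv.coe_coe] at key
  rw [hfun, key, h0]
  ext v
  simp

/-- **Time ordering in a diagonal frame.** If `(L x)⁰ = (x⁰ + t x¹)/√2` with `t r ≤ |r|` for all `r`
(i.e. `|t| ≤ 1`), then for a cone chain `G` the rotated test function `linActMulti L G = G ∘ L⁻¹`
(supported on `L · supp G`) is e₀-time-ordered: `y⁰ + t y¹ ≥ y⁰ − |y¹| > 0` and likewise for the
increments. -/
theorem isTimeOrdered_linActMulti_of_cone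
    (L : E4 ≃ₗᵢ[ℝ] E4) (t : ℝ)
    (ht : ∀ r : ℝ, t * r ≤ |r|)
    (hL : ∀ x : E4, L x 0 = (x 0 + t * x 1) / Real.sqrt 2)
    {m : ℕ} (G : SchwartzMap (Fin m → E4) ℂ)
    (hGcone : tsupport (G : (Fin m → E4) → ℂ) ⊆
      {x | (∀ i, |x i 1| < x i 0) ∧ ∀ i j, i < j → |x j 1 - x i 1| < x j 0 - x i 0}) :
    IsTimeOrdered (linActMulti L G) := by
  intro x hx
  obtain ⟨h1, h2⟩ := hGcone (mem_tsupport_of_mem_tsupport_linActMulti_four L G hx)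
  have hx0 : ∀ k, x k 0 = ((L.symm (x k)) 0 + t * (L.symm (x k)) 1) / Real.sqrt 2 := by
    intro k
    conv_lhs => rw [← L.apply_symm_apply (x k)]
    exact hL _
  have hs2 : 0 < Real.sqrt 2 := Real.sqrt_pos.2 two_pos
  refine ⟨fun k => ?_, fun i j hij => ?_⟩
  · rw [hx0]
    have hk := h1 k
    have htk := ht (-(L.symm (x k) 1))
    rw [abs_neg] at htk
    exact div_pos (by linarith) hs2
  · show x i 0 < x j 0
    rw [hx0 i, hx0 j]
    have hk := h2 i j hij
    have htk := ht (-(L.symm (x j) 1 - L.symm (x i) 1))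
    rw [abs_neg] at htk
    exact div_lt_div_of_pos_right (by linarith) hs2

/-! ## The pulled-back reconstructions and the pairing identity -/

/-- **`OSReconstructionNoE1` of a pulled-back family.** If `R e₀` is one of the eight frame
directions then `S ∘ linActMulti R` is reflection positive (the frame hypothesis) and translation
invariant on `⁰𝒮` (`linActMulti R (F(· − a)) = (linActMulti R F)(· − R a)`, isometries preserve
`⁰𝒮`). -/
theorem osReconstructionNoE1_pullback (S : SchwingerFamily E4)
    (hT : ∀ (n : ℕ) (a : E4)
      (F : SchwartzMap (Fin n → E4) ℂ), IsOffDiagonal F →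
      S n (translateMulti a F) = S n F)
    (hRP : ∀ (R : E4 ≃ₗᵢ[ℝ] E4) (a b : ℝ),
      a ^ 2 + b ^ 2 = 1 → (a = 0 ∨ b = 0 ∨ a ^ 2 = b ^ 2) →
      R (EuclideanSpace.single 0 1) =
          a • EuclideanSpace.single 0 1 + b • EuclideanSpace.single 1 1 →
        (SchwingerFamily.toLabelled (fun n => (S n).comp (linActMulti R))).IsReflectionPositive)
    (R : E4 ≃ₗᵢ[ℝ] E4) (a b : ℝ)
    (hab : a ^ 2 + b ^ 2 = 1) (h8 : a = 0 ∨ b = 0 ∨ a ^ 2 = b ^ 2)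
    (hR : R (EuclideanSpace.single 0 1) =
      a • EuclideanSpace.single 0 1 + b • EuclideanSpace.single 1 1) :
    OSReconstructionNoE1 (SchwingerFamily.toLabelled (fun k => (S k).comp (linActMulti R))) := by
  refine ⟨hRP R a b hab h8 hR, fun n _ c F hF => ?_⟩
  show S n (linActMulti R (translateMulti c F)) = S n (linActMulti R F)
  rw [linActMulti_translateMulti]
  exact hT n (R c) _ (isOffDiagonal_linActMulti_four hF R)

/-- **The pairing identity.** If `R⁻¹ θ R⁻¹ = θ` then for every `G` and translation vector `v`,
`ΘG* ⊗ G_{R v} = linActMulti R (Θ(G∘R⁻¹)* ⊗ (G∘R)_{v})`: `linActMulti` distributes over `⊗` and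
conjugates translations, `linActMulti R (linActMulti R⁻¹ G) = G`, and
`linActMulti R (osAdjoint (linActMulti R G)) = osAdjoint G` by the conjugation rule. -/
theorem pairing_pullback (R : E4 ≃ₗᵢ[ℝ] E4)
    (hθ : ∀ z : E4, R.symm (timeReflection 4 (R.symm z)) = timeReflection 4 z)
    {m : ℕ} (G : SchwartzMap (Fin m → E4) ℂ) (v : E4) :
    (osAdjoint G).appendTensor (translateMulti (R v) G) =
      linActMulti R ((osAdjoint (linActMulti R G)).appendTensor
        (translateMulti v (linActMulti R.symm G))) := by
  rw [linActMulti_appendTensor, linActMulti_translateMulti]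
  congr 1
  · ext x
    simp [linActMulti_apply, osAdjoint_apply, hθ]
  · congr 1
    ext x
    simp [linActMulti_apply]

/-! ## The stub -/

/-- **FRONT END, geometry — cone chains are diagonal-frame OS pairs.** For `S` translation
invariant on `⁰𝒮` with the crux's eight-frame pull-back RP and a cone chain `G`, there are two
frames `R₊, R₋ : ℝ⁴ ≃ₗᵢ ℝ⁴` (the rotations by `±45°` of the `(x₀,x₁)`-plane, `R₊e₀ = n`,
`R₋e₀ = n'`) whose pulled-back families `S ∘ linActMulti R±` satisfy the premises of
`OSReconstructionNoE1`, and e₀-time-ordered `A±, B±` with the Schwartz-map identities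
`ΘG* ⊗ G_{a(u,u')} = linActMulti R₊ (ΘA₊* ⊗ (B₊)_{u e₀ − u' e₁})` and
`ΘG* ⊗ G_{a(u,u')} = linActMulti R₋ (ΘA₋* ⊗ (B₋)_{u' e₀ + u e₁})` for all real `u, u'`.
Proof: `A± = linActMulti R± G`, `B± = linActMulti R±⁻¹ G` with `R± = exists_diagFrame (±1)`;
time ordering by `isTimeOrdered_linActMulti_of_cone`, the reconstructions by
`osReconstructionNoE1_pullback` at `(a,b) = (1/√2, ±1/√2)`, the identities by `pairing_pullback` and
`R₊ (u e₀ − u' e₁) = a(u,u') = R₋ (u' e₀ + u e₁)`. -/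
theorem stub_coneChainFrames
    (S : SchwingerFamily E4)
    (hT : ∀ (n : ℕ) (a : E4) (F : SchwartzMap (Fin n → E4) ℂ), IsOffDiagonal F →
      S n (translateMulti a F) = S n F)
    (hRP : ∀ (R : E4 ≃ₗᵢ[ℝ] E4) (a b : ℝ), a ^ 2 + b ^ 2 = 1 → (a = 0 ∨ b = 0 ∨ a ^ 2 = b ^ 2) →
      R (EuclideanSpace.single 0 1) = a • EuclideanSpace.single 0 1 + b • EuclideanSpace.single 1 1 →
      (SchwingerFamily.toLabelled (fun n => (S n).comp (linActMulti R))).IsReflectionPositive)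
    {m : ℕ} (G : SchwartzMap (Fin m → E4) ℂ)
    (hGcone : tsupport (G : (Fin m → E4) → ℂ) ⊆
      {x | (∀ i, |x i 1| < x i 0) ∧ ∀ i j, i < j → |x j 1 - x i 1| < x j 0 - x i 0}) :
    ∃ (Rp Rm : E4 ≃ₗᵢ[ℝ] E4) (Ap Bp Am Bm : SchwartzMap (Fin m → E4) ℂ),
      IsTimeOrdered Ap ∧ IsTimeOrdered Bp ∧ IsTimeOrdered Am ∧ IsTimeOrdered Bm ∧
      OSReconstructionNoE1 (SchwingerFamily.toLabelled (fun k => (S k).comp (linActMulti Rp))) ∧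
      OSReconstructionNoE1 (SchwingerFamily.toLabelled (fun k => (S k).comp (linActMulti Rm))) ∧
      (∀ u u' : ℝ, (osAdjoint G).appendTensor
          (translateMulti (((u + u') / Real.sqrt 2) • EuclideanSpace.single 0 1 +
            ((u - u') / Real.sqrt 2) • EuclideanSpace.single 1 1) G) =
        linActMulti Rp ((osAdjoint Ap).appendTensor
          (translateMulti (u • EuclideanSpace.single 0 1 + (-u') • EuclideanSpace.single 1 1) Bp))) ∧
      (∀ u u' : ℝ, (osAdjoint G).appendTensor
          (translateMulti (((u + u') / Real.sqrt 2) • EuclideanSpace.single 0 1 +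
            ((u - u') / Real.sqrt 2) • EuclideanSpace.single 1 1) G) =
        linActMulti Rm ((osAdjoint Am).appendTensor
          (translateMulti (u' • EuclideanSpace.single 0 1 + u • EuclideanSpace.single 1 1) Bm))) := by
  obtain ⟨Rp, hp0, hp1, hp0', -, hpi, hpθ, hpe⟩ := exists_diagFrame 1 (Or.inl rfl)
  obtain ⟨Rm, hm0, hm1, hm0', -, hmi, hmθ, hme⟩ := exists_diagFrame (-1) (Or.inr rfl)
  have hsq : Real.sqrt 2 ^ 2 = 2 := Real.sq_sqrt zero_le_two
  have hle : ∀ r : ℝ, 1 * r ≤ |r| := fun r => by rw [one_mul]; exact le_abs_self r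
  have hle' : ∀ r : ℝ, -1 * r ≤ |r| := fun r => by rw [neg_one_mul]; exact neg_le_abs r
  have hab : (1 / Real.sqrt 2) ^ 2 + (1 / Real.sqrt 2) ^ 2 = 1 := by
    rw [div_pow, one_pow, hsq]; norm_num
  have hab' : (1 / Real.sqrt 2) ^ 2 + (-1 / Real.sqrt 2) ^ 2 = 1 := by
    rw [div_pow, div_pow, one_pow, hsq]; norm_num
  have h8' : (1 / Real.sqrt 2) ^ 2 = (-1 / Real.sqrt 2) ^ 2 := by
    rw [div_pow, div_pow]; norm_num
  refine ⟨Rp, Rm, linActMulti Rp G, linActMulti Rp.symm G, linActMulti Rm G, linActMulti Rm.symm G,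
    ?_, ?_, ?_, ?_, ?_, ?_, fun u u' => ?_, fun u u' => ?_⟩
  · exact isTimeOrdered_linActMulti_of_cone Rp (-1) hle' (fun x => by rw [hp0]; ring) G hGcone
  · exact isTimeOrdered_linActMulti_of_cone Rp.symm 1 hle hp0' G hGcone
  · exact isTimeOrdered_linActMulti_of_cone Rm 1 hle (fun x => by rw [hm0]; ring) G hGcone
  · exact isTimeOrdered_linActMulti_of_cone Rm.symm (-1) hle' hm0' G hGcone
  · exact osReconstructionNoE1_pullback S hT hRP Rp _ _ hab (Or.inr (Or.inr rfl)) hpe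
  · exact osReconstructionNoE1_pullback S hT hRP Rm _ _ hab' (Or.inr (Or.inr h8')) hme
  · have hv : Rp (u • EuclideanSpace.single 0 1 + (-u') • EuclideanSpace.single 1 1) =
        ((u + u') / Real.sqrt 2) • EuclideanSpace.single 0 1 +
          ((u - u') / Real.sqrt 2) • EuclideanSpace.single 1 1 := by
      ext i
      fin_cases i
      · simp [hp0]; ring
      · simp [hp1]; ring
      · simp [(hpi _ 2 (by decide) (by decide)).1]
      · simp [(hpi _ 3 (by decide) (by decide)).1]
    rw [← hv]
    exact pairing_pullback Rp hpθ G _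
  · have hv : Rm (u' • EuclideanSpace.single 0 1 + u • EuclideanSpace.single 1 1) =
        ((u + u') / Real.sqrt 2) • EuclideanSpace.single 0 1 +
          ((u - u') / Real.sqrt 2) • EuclideanSpace.single 1 1 := by
      ext i
      fin_cases i
      · simp [hm0]; ring
      · simp [hm1]; ring
      · simp [(hmi _ 2 (by decide) (by decide)).1]
      · simp [(hmi _ 3 (by decide) (by decide)).1]
    rw [← hv]
    exact pairing_pullback Rm hmθ G _

end Summit.QuantumFields.YangMills.Cruxes.PlanarSpectralCone.TwoMirrorLightconeSlots
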